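import Mathlib
import Summits.SmoothPoincare4.SmoothPoincare4.Theorems.CylinderEntropyCylinderRungTwoKCertArith
import Literature.Analysis.ValidatedNumerics.MultiPrecisionInterval
import HarnessLib

/-!
# Kernel certificate checker for `stub_certMid`, III: the computable second-order checker

Infrastructure file 3 for the kernel-clean discharge of the registered stub `stub_certMid` of crux
stmt-SmoothPoincare4-7631 (`Summit.SmoothPoincare4.SmoothPoincare4.Theses.CylinderEntropy.CylinderRungTwo`, line `killing-flux`).
This file only DEFINES the checker `KCert.checkCover` (all `def`s computable over `ℚ`/`ℕ`, structural recursion, so that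
`decide +kernel` evaluates them); its soundness is proved in the sequel files.  What is checked, per `T`-cell `[T₁, T₂]`
carrying on-axis zonal atoms `w_j · zonal(τ_j, cos θ) · e^{-(u-σ_j)²/(4τ_j)}` (`τ_j = -log(q_j)/2 ∈ [tlo_j, thi_j]`) plus an
area atom `c`:

* atom / mass / `u`-tail validation as in the tree's `Cert.checkCell` (outside `[uMin, uMax]` the pulled-back kernel
  `E_T(u, s) = (6T²)⁻¹ e^{4u} e^{-(e^{2u} - 2e^u s + 1)/(4T)}` is below `c`);
* a θ-GRID `0 = θ₀ < θ₁ < … < θ_N = π` given by rational `s_i = cos θ_i` with certified enclosures `θ_i ∈ [tlo_i, thi_i]`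
  (`KCert.cosPair`), and per atom the certified table `zlo_i ≤ zonal(τ, s_i) ≤ zhi_i` (`KCert.zlo/zhi`) with VERIFIED slope
  data `mlo_i ≤ f'(θ_i) ≤ mhi_i` of Hamilton's convex function `f(θ) = log zonal(τ, cos θ) + θ²/(4τ)` (secant tests through
  `expLo/expHi`; invalid data silently falls back to the trivial bounds `0 ≤ f' ≤ π/(2τ)`), whence tangent-line MINORANTS and
  end-point MAJORANTS of every atom on every θ-range;
* all box-level arithmetic in integer fixed point (`MI` of `Literature/Analysis/ValidatedNumerics/MultiPrecisionInterval`, scale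
  `2^64`; rational arithmetic is ~40× slower under kernel reduction), only tables and `exp` arguments in `ℚ`;
* a script-driven bisection of `[uMin, uMax] × [0, π]` in the coordinates `(u, θ)`; on each leaf box either the zeroth-order
  test `sup E ≤ inf R` or the second-order CORNER test `min_corners (R - E) ≥ h_u · sup|∂_u(R - E_T)| + h_θ · sup|∂_θ(R - E_T)|`
  (interval enclosures of the two partial derivatives; `T` restricted to the envelope range of the box).
No named facts; nothing here is asserted, only defined.
-/

-- the registered namespace `Summit.SmoothPoincare4.SmoothPoincare4.…` repeats a component
set_option linter.dupNamespace false

namespace Summit.SmoothPoincare4.SmoothPoincare4.Cruxes.CylinderRungTwo.KillingFlux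

namespace KCert

open Summit.SmoothPoincare4.SmoothPoincare4.Theorems.CylinderEntropySliceIsolation.Cert
open Literature.Analysis.ValidatedNumerics.NumericsMP (MI)

/-! ### Data -/

/-- An on-axis zonal atom `w · zonal(τ, s) · e^{-(u-σ)²/(4τ)}` at `τ = -log(q)/2`, with claimed bounds
`tlo ≤ τ ≤ thi` (validated) and the truncation order `K` of its series. [folklore] -/
structure KAtom where
  /-- `q = e^{-2τ}` -/
  q : ℚ
  /-- claimed lower bound of `τ` -/
  tlo : ℚ
  /-- claimed upper bound of `τ` -/
  thi : ℚ
  /-- centre height -/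
  σ : ℚ
  /-- weight -/
  w : ℚ
  /-- truncation order -/
  K : ℕ

/-- A grid point `θ_i = arccos s_i` with its claimed enclosure `[tlo, thi]` (validated). [folklore] -/
structure GridPt where
  /-- `s = cos θ` (rational) -/
  s : ℚ
  /-- claimed lower bound of `θ` -/
  tlo : ℚ
  /-- claimed upper bound of `θ` -/
  thi : ℚ

/-- A `T`-cell with its certificate and checker data. [folklore] -/
structure KCell where
  /-- left end of the cell -/
  T1 : ℚ
  /-- right end of the cell -/
  T2 : ℚ
  /-- area atom -/
  c : ℚ
  /-- the atoms -/
  atoms : List KAtom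
  /-- lower end of the bisected `u`-range -/
  uMin : ℚ
  /-- upper end of the bisected `u`-range -/
  uMax : ℚ
  /-- fractional bits kept by the roundings -/
  prec : ℕ
  /-- the θ-grid (ascending in θ, from `θ = 0` to `θ = π`) -/
  grid : List GridPt
  /-- claimed slope lower bounds `mlo_{j,i} ≤ f_j'(θ_i)` (per atom, per grid point) -/
  mlo : List (List ℚ)
  /-- claimed slope upper bounds `f_j'(θ_i) ≤ mhi_{j,i}` -/
  mhi : List (List ℚ)

/-- Twenty-digit lower bound of `π` (`Real.pi_gt_d20`). [folklore] -/
def piLo : ℚ := 3.14159265358979323846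

/-- Twenty-digit upper bound of `π` (`Real.pi_lt_d20`). [folklore] -/
def piHi : ℚ := 3.14159265358979323847

/-- The default (junk) grid point. [folklore] -/
def gridD : GridPt := ⟨1, 0, 0⟩

/-! ### Tables -/

/-- A table entry of an atom at a grid point: the certified values `zlo ≤ zonal ≤ zhi`, the EFFECTIVE (verified or
fallback) slope bounds `mlo ≤ f' ≤ mhi`, the certified lower bound `cello` of the atom's zonal factor on the whole grid
cell to the right, and the certified upper bound `expf ≥ e^{f(θ_i)}`. [folklore] -/
structure TabE where
  /-- `zlo ≤ zonal(τ, s_i)` (`≥ 0`) -/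
  zlo : ℚ
  /-- `zonal(τ, s_i) ≤ zhi` -/
  zhi : ℚ
  /-- `mlo ≤ f'(θ_i)`, `0 ≤ mlo` -/
  mlo : ℚ
  /-- `f'(θ_i) ≤ mhi` -/
  mhi : ℚ
  /-- lower bound of `zonal(τ, cos θ)` for `θ ∈ [θ_i, θ_{i+1}]` -/
  cello : ℚ
  /-- `e^{f(θ_i)} ≤ expf` -/
  expf : ℚ
  deriving DecidableEq

/-- The default (junk) table entry. [folklore] -/
def tabD : TabE := ⟨0, 0, 0, 0, 0, 0⟩

/-- The raw two-sided zonal values of an atom along the grid (rounded outward to `prec` bits, so that no table entry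
carries the thousands of digits of the exact sharp tail). [folklore] -/
def rawTab (C : KCell) (a : KAtom) : List (ℚ × ℚ) :=
  C.grid.map fun g => (rdn (zlo a.q g.s a.K C.prec) C.prec, rup (zhi a.q g.s a.K C.prec) C.prec)

/-- The effective slope lower bound at grid index `i` (verified secant test to the left, else `0`). [folklore] -/
def mloEff (C : KCell) (a : KAtom) (raw : List (ℚ × ℚ)) (dlo : List ℚ) (i : ℕ) : ℚ :=
  if i = 0 then 0 else
    let gi := C.grid.getD i gridD
    let gp := C.grid.getD (i - 1) gridD
    let zi := (raw.getD i (0, 0)).1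
    let zp := (raw.getD (i - 1) (0, 0)).2
    let m := dlo.getD i 0
    let br := (gi.tlo + gp.tlo) / (4 * a.thi) - m
    if 0 ≤ m ∧ 0 < zi ∧ 0 ≤ br ∧ gp.thi < gi.tlo ∧ zp ≤ zi * expLo ((gi.tlo - gp.thi) * br) C.prec then m else 0

/-- The effective slope upper bound at grid index `i` (verified secant test to the right, else `π/(2τ)`). [folklore] -/
def mhiEff (C : KCell) (a : KAtom) (raw : List (ℚ × ℚ)) (dhi : List ℚ) (i : ℕ) : ℚ :=
  let fb := piHi / (2 * a.tlo)
  if C.grid.length ≤ i + 1 then fb else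
    let gi := C.grid.getD i gridD
    let gn := C.grid.getD (i + 1) gridD
    let zi := (raw.getD i (0, 0)).1
    let zn := (raw.getD (i + 1) (0, 0)).2
    let m := dhi.getD i fb
    let brMin := (gn.tlo + gi.tlo) / (4 * a.thi) - m
    let brMax := (gn.thi + gi.thi) / (4 * a.tlo) - m
    if 0 < zi ∧ 0 ≤ brMin ∧ gi.thi < gn.tlo ∧ m ≤ fb ∧ zn * expHi ((gn.thi - gi.tlo) * brMax) C.prec ≤ zi then m else fb

/-- The table entry at grid index `i`. [folklore] -/
def tabEntry (C : KCell) (a : KAtom) (raw : List (ℚ × ℚ)) (dlo dhi : List ℚ) (i : ℕ) : TabE :=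
  let gi := C.grid.getD i gridD
  let gn := C.grid.getD (i + 1) gridD
  let zi := (raw.getD i (0, 0)).1
  let hi := (raw.getD i (0, 0)).2
  let ml := mloEff C a raw dlo i
  let mh := mhiEff C a raw dhi i
  let enext : ℚ :=
    if 0 < zi ∧ i + 1 < C.grid.length then
      rdn (zi * expLo (ml * (gn.tlo - gi.thi) - (gn.thi ^ 2 - gi.tlo ^ 2) / (4 * a.tlo)) C.prec) C.prec
    else 0
  ⟨zi, hi, ml, mh, min zi enext, rup (hi * expHi (gi.thi ^ 2 / (4 * a.tlo)) C.prec) C.prec⟩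

/-- The default (junk) atom. [folklore] -/
def atomD : KAtom := ⟨1 / 2, 1, 1, 0, 0, 0⟩

/-- The table of an atom from its raw values (one entry per grid point). [folklore] -/
def tabOfRaw (C : KCell) (a : KAtom) (raw : List (ℚ × ℚ)) (dlo dhi : List ℚ) : List TabE :=
  (List.range C.grid.length).map fun i => tabEntry C a raw dlo dhi i

/-- The raw tables of all atoms (the expensive part: one zonal series per atom and grid point). [folklore] -/
def rawsOf (C : KCell) : List (List (ℚ × ℚ)) := C.atoms.map (rawTab C)

/-- The tables of all atoms from given raw tables. [folklore] -/
def tabsFrom (C : KCell) (raws : List (List (ℚ × ℚ))) : List (List TabE) :=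
  (List.range C.atoms.length).map fun j =>
    tabOfRaw C (C.atoms.getD j atomD) (raws.getD j []) (C.mlo.getD j []) (C.mhi.getD j [])

/-- The tables of all atoms. [folklore] -/
def tabsOf (C : KCell) : List (List TabE) := tabsFrom C (rawsOf C)

/-! ### A kernel-friendly integer square root

`Nat.sqrt` is defined by well-founded recursion and does not reduce in the kernel; the Newton iteration below is
structurally recursive on a fuel argument and its result is VALIDATED where it is used (so its correctness need not be
proved). -/

/-- Newton's iteration `x ↦ (x + n/x)/2` from above, `fuel` steps or until it stops decreasing. [folklore] -/
def isqrtF : ℕ → ℕ → ℕ → ℕ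
  | 0, _, x => x
  | fuel + 1, n, x =>
    let y := (x + n / x) / 2
    if y < x then isqrtF fuel n y else x

/-- Integer square root candidate (validated by its users). [folklore] -/
def isqrt (n : ℕ) : ℕ := isqrtF 200 n (2 ^ (Nat.log2 n / 2 + 1))

/-- Lower bound of `√x` to `p` bits: `r/2^p` if `r² ≤ ⌊x 4^p⌋₊` for the candidate `r`, else `0`. [folklore] -/
def ksqrtLo (x : ℚ) (p : ℕ) : ℚ :=
  let m := ⌊x * 4 ^ p⌋₊
  let r := isqrt m
  if r * r ≤ m then (r : ℚ) / 2 ^ p else 0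

/-- Upper bound of `√x` to `p` bits: `(r+1)/2^p` if `⌊x 4^p⌋₊ < (r+1)²` for the candidate `r`, else `max 1 x`. [folklore] -/
def ksqrtHi (x : ℚ) (p : ℕ) : ℚ :=
  let m := ⌊x * 4 ^ p⌋₊
  let r := isqrt m + 1
  if m < r * r then (r : ℚ) / 2 ^ p else max 1 x

/-! ### Point data -/

/-! ### Scaled integers and integer intervals (scale `2^64`)

All box-level quantities are carried as integers `k` standing for the real `k / 2^64`, and as the integer intervals
`MI` of `Literature.Analysis.ValidatedNumerics.MultiPrecisionInterval` (`MI.mem S x I ↔ I.lo ≤ x·S ≤ I.hi`): rational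
arithmetic with its `gcd` normalisations is about forty times slower under kernel reduction (measured), so only the tables and
the arguments of `exp` stay in `ℚ`. -/

/-- The scale `S = 2^64`. [folklore] -/
def S64 : ℕ := 18446744073709551616

/-- `⌊q · S⌋`. [folklore] -/
def zlo64 (q : ℚ) : ℤ := ⌊q * (S64 : ℚ)⌋

/-- `⌈q · S⌉`. [folklore] -/
def zhi64 (q : ℚ) : ℤ := ⌈q * (S64 : ℚ)⌉

/-- `k / S` as a rational. [folklore] -/
def toQ (k : ℤ) : ℚ := (k : ℚ) / (S64 : ℚ)

/-- The thin interval `[⌊qS⌋, ⌈qS⌉]` of a rational. [folklore] -/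
def ofQ (q : ℚ) : MI := ⟨zlo64 q, zhi64 q⟩

/-- Ceiling division (`b > 0`). [folklore] -/
def cdivZ (a b : ℤ) : ℤ := -((-a) / b)

/-- Floor of a product of three nonnegative scaled integers: `⌊⌊a b / S⌋ c / S⌋`. [folklore] -/
def mul3lo (a b c : ℤ) : ℤ := a * b / (S64 : ℤ) * c / (S64 : ℤ)

/-! ### A fixed-point cosine -/

/-- One certified doubling `cos 2y = 2cos²y - 1` at scale `W`, lower end clamped at `0`. [folklore] -/
def cosStepZ (W : ℕ) (c : ℤ × ℤ) : ℤ × ℤ :=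
  (max 0 ((2 * c.1 * c.1 - (W : ℤ) * W) / W), cdivZ (2 * c.2 * c.2 - (W : ℤ) * W) W)

/-- The last doubling (no clamp). [folklore] -/
def cosStepZN (W : ℕ) (c : ℤ × ℤ) : ℤ × ℤ :=
  ((2 * c.1 * c.1 - (W : ℤ) * W) / W, cdivZ (2 * c.2 * c.2 - (W : ℤ) * W) W)

/-- `n` clamped doublings. [folklore] -/
def cosIterZ (W : ℕ) (c : ℤ × ℤ) : ℕ → ℤ × ℤ
  | 0 => c
  | n + 1 => cosStepZ W (cosIterZ W c n)

/-- **Enclosure of `cos t` for `t ∈ [0, π]`** at scale `2^64` (computed at scale `2^104`): `cos (t/2¹⁸)` from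
`1 - x²/2 ≤ cos x ≤ 1 - x²/2 + (5/96)x⁴`, then eighteen doublings. [folklore] -/
def cosI (t : ℚ) : MI :=
  let W : ℕ := 2 ^ 104
  let x := t / 2 ^ 18
  let lo0 : ℤ := max 0 ⌊(1 - x ^ 2 / 2) * (W : ℚ)⌋
  let hi0 : ℤ := ⌈(1 - x ^ 2 / 2 + 5 * x ^ 4 / 96) * (W : ℚ)⌉
  let c17 := cosIterZ W (lo0, hi0) 17
  let c18 := cosStepZN W c17
  ⟨c18.1 / 2 ^ 40, cdivZ c18.2 (2 ^ 40)⟩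

/-- The clamped enclosure of `cos (min t π)` for `0 ≤ t` (lower `≥ -S`, upper `≤ S`). [folklore] -/
def cosAtI (t : ℚ) : MI :=
  if t < piLo then
    let c := cosI t
    ⟨max (-(S64 : ℤ)) c.lo, min (S64 : ℤ) c.hi⟩
  else ⟨-(S64 : ℤ), min (S64 : ℤ) (cosI piLo).hi⟩

/-! ### Point data -/

/-- The last grid index `i ∈ [lo, hi]` with `thi_i ≤ t` (so `θ_i ≤ t`), else `0` (`θ_0 = 0`): valid by construction.
[folklore] -/
def idxBelowIn (grid : List GridPt) (t : ℚ) (lo hi : ℕ) : ℕ :=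
  ((List.range (hi + 1 - lo)).map (· + lo)).foldl (fun best i => if (grid.getD i gridD).thi ≤ t then i else best) 0

/-- The first grid index `i ∈ [lo, hi]` with `t ≤ tlo_i` (so `t ≤ θ_i`), else the last index (`θ = π`). [folklore] -/
def idxAboveIn (grid : List GridPt) (t : ℚ) (lo hi : ℕ) : ℕ :=
  (((List.range (hi + 1 - lo)).map (· + lo)).find? fun i => decide (t ≤ (grid.getD i gridD).tlo)).getD (grid.length - 1)

/-- Data attached to a θ-end-point `t ∈ [0, πhi]` of a box (real angle `θ̂ = min t π`). [folklore] -/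
structure TD where
  /-- the end point (exact) -/
  t : ℚ
  /-- enclosure of `cos θ̂` (scale `2^64`) -/
  cs : MI
  /-- a grid index with `θ_ia ≤ θ̂` -/
  ia : ℕ
  /-- a grid index with `θ̂ ≤ θ_ib` -/
  ib : ℕ
  /-- per atom: scaled lower bound of `zonal(τ_j, cos θ̂)` (tangent form from `θ_ia`) -/
  tfl : List ℤ
  /-- per atom: scaled upper bound of `e^{-t²/(4τ_j)}` -/
  hup : List ℤ

/-- The tangent-form lower bound of an atom's zonal factor at `θ = min t π` (rational). [folklore] -/
def tflOf (C : KCell) (a : KAtom) (tab : List TabE) (ia : ℕ) (t : ℚ) : ℚ :=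
  let e := tab.getD ia tabD
  let g := C.grid.getD ia gridD
  let tl := min t piLo
  if 0 < e.zlo then max 0 (e.zlo * expLo (e.mlo * (tl - g.thi) - (t ^ 2 - g.tlo ^ 2) / (4 * a.tlo)) C.prec)
  else 0

/-- The θ-point data at `t`, grid indices searched in the hinted ranges (any hint is sound). [folklore] -/
def mkTDh (C : KCell) (tabs : List (List TabE)) (t : ℚ) (iaLo iaHi ibLo ibHi : ℕ) : TD :=
  let ia := idxBelowIn C.grid (min t piLo) iaLo iaHi
  let ib := idxAboveIn C.grid t ibLo ibHi
  ⟨t, cosAtI t, ia, ib,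
    (List.range C.atoms.length).map fun j =>
      zlo64 (tflOf C (C.atoms.getD j atomD) (tabs.getD j []) ia t),
    C.atoms.map fun a => zhi64 (expHi (-t ^ 2 / (4 * a.thi)) C.prec)⟩

/-- The θ-point data at `t` (full grid search). [folklore] -/
def mkTD (C : KCell) (tabs : List (List TabE)) (t : ℚ) : TD :=
  mkTDh C tabs t 0 (C.grid.length - 1) 0 (C.grid.length - 1)

/-- Data attached to a `u`-end-point of a box. [folklore] -/
structure UD where
  /-- the end point (exact) -/
  u : ℚ
  /-- enclosure of `e^u` (scale `2^64`) -/
  x : MI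
  /-- per atom: scaled lower bound of `e^{-(u-σ_j)²/(4τ_j)}` -/
  glo : List ℤ
  /-- per atom: scaled upper bound of `e^{-(u-σ_j)²/(4τ_j)}` -/
  ghi : List ℤ

/-- The `u`-point data at `u`. [folklore] -/
def mkUD (C : KCell) (u : ℚ) : UD :=
  ⟨u, ⟨zlo64 (expLo u C.prec), zhi64 (expHi u C.prec)⟩,
    C.atoms.map fun a => zlo64 (expLo (-(u - a.σ) ^ 2 / (4 * a.tlo)) C.prec),
    C.atoms.map fun a => zhi64 (expHi (-(u - a.σ) ^ 2 / (4 * a.thi)) C.prec)⟩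

/-- The rational upper bound of `sup_{T ∈ [T₁,T₂]} E_T` over `e^u ∈ [xlo, xhi]`, `cos θ ≤ chi` (exact `T`-envelope). [folklore] -/
def eUpperQ (C : KCell) (xlo xhi chi : ℚ) : ℚ :=
  let r := clampQ chi xlo xhi
  let Qlo := (r - chi) ^ 2 + (1 - chi ^ 2)
  let Tc := clampQ (Qlo / 8) C.T1 C.T2
  rup (xhi ^ 4 * expHi (-Qlo / (4 * Tc)) C.prec / (6 * Tc ^ 2)) C.prec

/-- Scaled upper bound of `sup_T E_T` at the corner `(u, min t π)`. [folklore] -/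
def eCorner (C : KCell) (U : UD) (T : TD) : ℤ :=
  zhi64 (eUpperQ C (toQ U.x.lo) (toQ U.x.hi) (toQ T.cs.hi))

/-- Scaled lower bound of the certificate `R` at the corner `(u, min t π)`: `c + Σ w_j glo_j tfl_j` (floors). [folklore] -/
def rCorner (C : KCell) (U : UD) (T : TD) : ℤ :=
  zlo64 C.c + (List.zipWith3 (fun (a : KAtom) (g f : ℤ) => mul3lo (zlo64 a.w) g f) C.atoms U.glo T.tfl).sum

end KCert

/-- Registered sub-goal marker `stub_certMid_part12` of crux stmt-SmoothPoincare4-7631 (helper file 3-a of the kernel-clean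
`stub_certMid`, line killing-flux): ceiling rounding at the checker's scale. [folklore] -/
theorem stub_certMid_part12 : ∀ q : ℚ, q * 18446744073709551616 ≤ ((⌈q * 18446744073709551616⌉ : ℤ) : ℚ) :=
  fun _ => Int.le_ceil _

end Summit.SmoothPoincare4.SmoothPoincare4.Cruxes.CylinderRungTwo.KillingFlux
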